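import Summits.QuantumFields.YangMills.Theorems.LuscherReductionDressedRitzPolyakovLiftDefs
import Summits.QuantumFields.YangMills.Theorems.LuscherReductionDressedRitzPolyakovLiftDressed
import Summits.QuantumFields.YangMills.Theorems.FemtoTransferGapGroundState
import HarnessLib

/-!
# Route `LuscherReduction`, item `DressedRitz` (stmt-QuantumFields-20205), line «polyakovlift», stub S-POS — blueprint step (A) TYPED and COMPOSED with (B):
# `UniversalityAt k` (pure field-theory universality: fine dressed channel numbers = one-site shadow numbers) ∧ `PScalingDressedAt k` (pure one-site)
# ⟹ the REGISTERED r3 text of `stub_liftPosition` (kernel-checked; the owner's condition for the S-POS registry split — LEAD prover ym-lead-20205-polyakovlift g0)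

Owner word (W1) 2026-08-27T11:50:27Z: «S-POS registry split only when (A) typed & composes».  This file does both.

OBJECTS.  Fine side (tree): the dressed lift `u_i = dressedLiftFamily β φ g i = K_β^[L](ins φ (g_i ∘ Π_t ∘ flow))`.  One-site SHADOW (here): at coupling
`B = oneSiteCoupling β L = B₁L³` with a one-site raw vacuum `e₀`, `w_i = shadowFamily B L e₀ g i := K_B^[L](ins e₀ (g_i ∘ powLink L))` — the SAME
one-site eigen-ratios read on the L-th POWERS of the three links (the Polyakov triple of the constant configuration), vacuum-subtracted against the
B-ground state and dressed by the SAME number `L` of one-site transfer steps (tree-level dictionary: one fine step = one B-model step).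
Numbers: `n_il = ⟨·_i, ·_l⟩`, `d_il = ⟨·_i, K ·_l⟩`, Rayleigh ratios `ρ_i = d_ii/n_ii`, top values `λ₀` (fine) ∕ `μ₀(B)` (one-site).

(A) `UniversalityAt k` — for EVERY lift basis and every pair of raw vacua, deep in the window:
  (An) `|n^f_ii − n^o_ii| ≤ Cλ·n^o_ii` (diagonal Gram numbers agree to relative `O(λ)`);
  (A5) `ρ^f_i/λ₀ = (ρ^o_i/μ₀)·e^{±Cλ²/L}` (one-step effective ratios agree to relative `O(λ²/L)`, i.e. effective ENERGIES to absolute `O(λ²/L)`;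
       product form, no division);
  (A6) `|F_il·μ₀ − G_il·λ₀| ≤ C(λ²/L)λ₀μ₀√(n^o_ii n^o_ll)`, `F ∕ G` = the fine ∕ one-site symmetrised coupling defects `d_il − ½(ρ_i+ρ_l)n_il`.
  This is the FIELD-THEORETIC content of S-POS and nothing else: no one-site spectral information enters.  (XL, open: Bałaban RG + BO.)
(B) `PScalingDressedAt k` — pure ONE-SITE semiclassics in two couplings (`Λ` a free parameter, no `β`, no window): for every lift basis at `B₁ = 2/Λ³`
  and every one-site raw vacuum at `B = 2L³/Λ³`, SOME relabelling `τ` of the shadow family has (o0′) positive norms, (o5′) Lüscher position against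
  `μ_{i+1}(B)/μ₀(B)` with tolerance `e^{±CΛ²/L}`, (o6′) coupling defect `≤ C(Λ²/L)μ₀√(n n)`.  (L-sized, ONE-type, numerically decidable; dressed twin of
  evidence #22 `PScalingAt`.)
★ `liftPositionR3_of_universality_pscaling : (∀ k, UniversalityAt k) → (∀ k, PScalingDressedAt k) → LiftPositionR3` (= the r3 text of
  `Stmt.stub_liftPosition`, re-homed here CHARACTER FOR CHARACTER) — (o5): multiply the two exponential sandwiches and cancel `n^o_ii μ₀ > 0`; (o6): triangle inequality + (An) to
  convert one-site norms into fine norms (`√(n^o n^o) ≤ 2√(n^f n^f)` once `Cλ ≤ 1/2`).  Constants: `C_A + C_B` resp. `4(C_A + C_B)`.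

HONEST FRAMING: typing + pure-real composition on the conditional femto rung R2b1; (A) and (B) are OPEN (field-theoretic RG resp. one-site
semiclassics); nothing here bears on infinite volume, the continuum limit or the Clay gap.  References: M. Lüscher, NPB 219 (1983) 233
[cite: Luscher1983, §3]; M. Lüscher, U. Wolff, NPB 339 (1990) 222 [cite: LuscherWolff1990].
-/

set_option autoImplicit false

noncomputable section

open MeasureTheory Filter Topology Real
open Literature.MathematicalPhysics.QuantumFieldTheory (GaugeConfig Site gaugeTransform)
open scoped BigOperators

namespace Summit.QuantumFields.YangMills.Theorems.FemtoTransferGap.PolyakovLift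

open Summit.QuantumFields.YangMills.Theorems.FemtoTransferGap

/-! ## §0 The one-site shadow of the dressed lift -/

/-- Componentwise `L`-th power of a one-site configuration (the Polyakov triple of the constant `L`-lattice configuration). [folklore] -/
def powLink (L : ℕ) (V : GaugeConfig 3 1 SU2) : GaugeConfig 3 1 SU2 := fun e => V e ^ L

/-- The one-site SHADOW of a dressed lifted channel vector: `K_B^[L](ins e₀ (g ∘ powLink L))` in the one-site model at coupling `B`. [cite: Luscher1983, §3] -/
def shadowVec (B : ℝ) (L : ℕ) (e₀ : GaugeConfig 3 1 SU2 → ℝ) (g : GaugeConfig 3 1 SU2 → ℝ) : GaugeConfig 3 1 SU2 → ℝ :=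
  (transferApply (L := 1) B)^[dressSteps L] (OpPlat.ins e₀ (g ∘ powLink L))

/-- The shadow family. [cite: Luscher1983, §3] -/
def shadowFamily {k : ℕ} (B : ℝ) (L : ℕ) (e₀ : GaugeConfig 3 1 SU2 → ℝ) (g : Fin k → (GaugeConfig 3 1 SU2 → ℝ)) :
    Fin k → (GaugeConfig 3 1 SU2 → ℝ) :=
  fun i => shadowVec B L e₀ (g i)

/-! ## §1 (A) UNIVERSALITY and (B) dressed PScaling, typed -/

/-- **(A) `UniversalityAt k`** — field-theoretic universality of the dressed flowed-Polyakov channel numbers: for every lift basis and all raw vacua, deep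
in the femto window, the fine numbers of `dressedLiftFamily β φ g` and the one-site numbers of `shadowFamily (oneSiteCoupling β L) L e₀ g` satisfy
(An) diagonal Gram agreement to relative `O(λ)`, (A5) one-step effective ratios agree to `e^{±Cλ²/L}` relative to the top values, (A6) symmetrised
coupling defects agree to `O(λ²/L)λ₀μ₀√(n n)`. [cite: Luscher1983, §3] [cite: LuscherWolff1990] -/
def UniversalityAt (k : ℕ) : Prop :=
  ∃ C lam0 : ℝ, 0 ≤ C ∧ 0 < lam0 ∧ ∀ lam : ℝ, 0 < lam → lam ≤ lam0 → ∃ L0 : ℕ,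
    ∀ (L : ℕ) [NeZero L], L0 ≤ L → ∀ β : ℝ, InFemtoWindow lam β L →
      ∀ φ : GaugeConfig 3 L SU2 → ℝ, IsRawVacuum β φ →
        ∀ (ω : GaugeConfig 3 1 SU2 → ℝ) (g : Fin k → (GaugeConfig 3 1 SU2 → ℝ)), LiftBasis (liftCoupling β L) k ω g →
          ∀ e₀ : GaugeConfig 3 1 SU2 → ℝ, IsRawVacuum (L := 1) (oneSiteCoupling β L) e₀ →
            let u := dressedLiftFamily β φ g
            let w := shadowFamily (oneSiteCoupling β L) L e₀ g
            let l0 := levelValue su2Rep L β 0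
            let m0 := levelValue su2Rep 1 (oneSiteCoupling β L) 0
            (∀ i : Fin k, |l2 (u i) (u i) - l2 (w i) (w i)| ≤ C * luscherLambda β L * l2 (w i) (w i)) ∧
            (∀ i : Fin k,
              l2 (u i) (transferApply β (u i)) * l2 (w i) (w i) * m0 ≤
                  Real.exp (C * luscherLambda β L ^ 2 / L) * (l2 (w i) (transferApply (oneSiteCoupling β L) (w i)) * l2 (u i) (u i) * l0) ∧
              l2 (w i) (transferApply (oneSiteCoupling β L) (w i)) * l2 (u i) (u i) * l0 ≤
                  Real.exp (C * luscherLambda β L ^ 2 / L) * (l2 (u i) (transferApply β (u i)) * l2 (w i) (w i) * m0)) ∧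
            (∀ i l : Fin k, i ≠ l →
              |(l2 (u i) (transferApply β (u l)) -
                  (l2 (u i) (transferApply β (u i)) / l2 (u i) (u i) + l2 (u l) (transferApply β (u l)) / l2 (u l) (u l)) / 2 *
                    l2 (u i) (u l)) * m0 -
                (l2 (w i) (transferApply (oneSiteCoupling β L) (w l)) -
                  (l2 (w i) (transferApply (oneSiteCoupling β L) (w i)) / l2 (w i) (w i) +
                      l2 (w l) (transferApply (oneSiteCoupling β L) (w l)) / l2 (w l) (w l)) / 2 * l2 (w i) (w l)) * l0|
                ≤ C * (luscherLambda β L ^ 2 / L) * l0 * m0 * (Real.sqrt (l2 (w i) (w i)) * Real.sqrt (l2 (w l) (w l))))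

/-- **(B) `PScalingDressedAt k`** — the one-site shadow satisfies the time-1 core clauses (pure one-site semiclassics, `Λ` free): for small `Λ`, large `L`,
every lift basis at `B₁ = 2/Λ³`, every one-site raw vacuum `e₀` at `B = 2L³/Λ³`, SOME relabelling `τ` of `shadowFamily B L e₀ g` has positive norms,
Lüscher position against `μ_{i+1}(B)/μ₀(B)` with tolerance `e^{±CΛ²/L}`, and coupling defects `≤ C(Λ²/L)μ₀(B)√(n n)`. [cite: Luscher1983, §3] -/
def PScalingDressedAt (k : ℕ) : Prop :=
  ∃ C lam0 : ℝ, 0 ≤ C ∧ 0 < lam0 ∧ ∀ lam : ℝ, 0 < lam → lam ≤ lam0 → ∃ L0 : ℕ, ∀ L : ℕ, L0 ≤ L →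
    ∀ Λ : ℝ, lam ≤ Λ → Λ ≤ 2 * lam →
      ∀ (ω : GaugeConfig 3 1 SU2 → ℝ) (g : Fin k → (GaugeConfig 3 1 SU2 → ℝ)), LiftBasis (2 / Λ ^ 3) k ω g →
        ∀ e₀ : GaugeConfig 3 1 SU2 → ℝ, IsRawVacuum (L := 1) (2 * (L : ℝ) ^ 3 / Λ ^ 3) e₀ →
          ∃ τ : Equiv.Perm (Fin k),
            let B : ℝ := 2 * (L : ℝ) ^ 3 / Λ ^ 3
            let w : Fin k → (GaugeConfig 3 1 SU2 → ℝ) := shadowFamily B L e₀ (fun i => g (τ i))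
            let m0 := levelValue su2Rep 1 B 0
            (∀ i : Fin k, 0 < l2 (w i) (w i)) ∧
            (∀ i : Fin k,
              l2 (w i) (transferApply B (w i)) * m0 ≤ Real.exp (C * Λ ^ 2 / L) * (levelValue su2Rep 1 B ((i : ℕ) + 1) * m0) * l2 (w i) (w i) ∧
              levelValue su2Rep 1 B ((i : ℕ) + 1) * m0 * l2 (w i) (w i) ≤ Real.exp (C * Λ ^ 2 / L) * (l2 (w i) (transferApply B (w i)) * m0)) ∧
            (∀ i l : Fin k, i ≠ l →
              |l2 (w i) (transferApply B (w l)) -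
                  (l2 (w i) (transferApply B (w i)) / l2 (w i) (w i) + l2 (w l) (transferApply B (w l)) / l2 (w l) (w l)) / 2 *
                    l2 (w i) (w l)|
                ≤ C * (Λ ^ 2 / L) * m0 * (Real.sqrt (l2 (w i) (w i)) * Real.sqrt (l2 (w l) (w l))))

/-! ## §2 The registered r3 text of S-POS, re-homed character for character -/

/-- The r3 text of the registered stub `…Cruxes.DressedRitz.PolyakovLift.Stmt.stub_liftPosition` (skeleton 11209be61e7d2ff5), VERBATIM body (a
stub prover re-homes it as `Stmt.stub_liftPosition` and closes it by `liftPositionR3_of_universality_pscaling`, which carries the citations).  This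
abbreviation is a re-homed skeleton statement text over Summits-side objects, deliberately WITHOUT a citation tag (a cited `Prop` abbreviation would
be relocated to `Literature/`, where `dressedLiftFamily` etc. do not exist; precedent `…TwistedTraceScalingStubOneSiteTraceLimit.lean`). -/
abbrev LiftPositionR3 : Prop :=
  ∀ k : ℕ, ∃ C lam0 : ℝ, 0 ≤ C ∧ 0 < lam0 ∧ ∀ lam : ℝ, 0 < lam → lam ≤ lam0 → ∃ L0 : ℕ,
    ∀ (L : ℕ) [NeZero L], L0 ≤ L → ∀ β : ℝ, InFemtoWindow lam β L →
      ∀ φ : GaugeConfig 3 L SU2 → ℝ, IsRawVacuum β φ →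
        ∃ (ω : GaugeConfig 3 1 SU2 → ℝ) (g : Fin k → (GaugeConfig 3 1 SU2 → ℝ)), LiftBasis (liftCoupling β L) k ω g ∧
          DynamicCoreClauses k C β (dressedLiftFamily β φ g)

/-! ## §3 Pure-real composition lemmas -/

/-- (o5) transfer: the two exponential sandwiches multiply (cancel `n^o μ₀ > 0`; norms and top values non-negative). [folklore] -/
theorem o5_transfer {df nf dw nw m0 m1 l0 EA EB : ℝ} (hnw : 0 < nw) (hm0 : 0 < m0) (hnf : 0 ≤ nf) (hl0 : 0 ≤ l0)
    (hEA : 0 < EA) (hEB : 0 < EB)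
    (hA1 : df * nw * m0 ≤ EA * (dw * nf * l0)) (hA2 : dw * nf * l0 ≤ EA * (df * nw * m0))
    (hB1 : dw * m0 ≤ EB * (m1 * m0) * nw) (hB2 : m1 * m0 * nw ≤ EB * (dw * m0)) :
    df * m0 ≤ EA * EB * (m1 * l0) * nf ∧ m1 * l0 * nf ≤ EA * EB * (df * m0) := by
  have hnfl0 : 0 ≤ nf * l0 := mul_nonneg hnf hl0
  have hdw : dw ≤ EB * m1 * nw := by
    have h : dw * m0 ≤ (EB * m1 * nw) * m0 := by calc dw * m0 ≤ EB * (m1 * m0) * nw := hB1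
      _ = (EB * m1 * nw) * m0 := by ring
    exact le_of_mul_le_mul_right h hm0
  have hm1 : m1 * nw ≤ EB * dw := by
    have h : m1 * nw * m0 ≤ (EB * dw) * m0 := by calc m1 * nw * m0 = m1 * m0 * nw := by ring
      _ ≤ EB * (dw * m0) := hB2
      _ = (EB * dw) * m0 := by ring
    exact le_of_mul_le_mul_right h hm0
  constructor
  · have h2 : df * m0 * nw ≤ (EA * EB * (m1 * l0) * nf) * nw := by
      calc df * m0 * nw = df * nw * m0 := by ring
        _ ≤ EA * (dw * nf * l0) := hA1
        _ = EA * dw * (nf * l0) := by ring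
        _ ≤ EA * (EB * m1 * nw) * (nf * l0) := mul_le_mul_of_nonneg_right (mul_le_mul_of_nonneg_left hdw hEA.le) hnfl0
        _ = (EA * EB * (m1 * l0) * nf) * nw := by ring
    exact le_of_mul_le_mul_right h2 hnw
  · have h1 : m1 * l0 * nf * nw ≤ (EA * EB * (df * m0)) * nw := by
      calc m1 * l0 * nf * nw = (m1 * nw) * (nf * l0) := by ring
        _ ≤ (EB * dw) * (nf * l0) := mul_le_mul_of_nonneg_right hm1 hnfl0
        _ = EB * (dw * nf * l0) := by ring
        _ ≤ EB * (EA * (df * nw * m0)) := mul_le_mul_of_nonneg_left hA2 hEB.le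
        _ = (EA * EB * (df * m0)) * nw := by ring
    exact le_of_mul_le_mul_right h1 hnw

/-- (o6) transfer: `|F| μ₀ ≤ |Fμ₀ − Gλ₀| + λ₀|G|` and one-site norms `≤ 4×` fine norms. [folklore] -/
theorem o6_transfer {F G m0 l0 a b sO sF : ℝ} (hm0 : 0 < m0) (hl0 : 0 ≤ l0)
    (hA : |F * m0 - G * l0| ≤ a * l0 * m0 * sO) (hB : |G| ≤ b * m0 * sO) (hs : sO ≤ 2 * sF) (ha : 0 ≤ a) (hb : 0 ≤ b) :
    |F| ≤ 2 * (a + b) * l0 * sF := by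
  have h1 : |F * m0| ≤ a * l0 * m0 * sO + l0 * (b * m0 * sO) := by
    calc |F * m0| = |(F * m0 - G * l0) + G * l0| := by ring_nf
      _ ≤ |F * m0 - G * l0| + |G * l0| := abs_add_le _ _
      _ ≤ a * l0 * m0 * sO + l0 * (b * m0 * sO) := by
          rw [abs_mul, abs_of_nonneg hl0, mul_comm |G| l0]
          exact add_le_add hA (mul_le_mul_of_nonneg_left hB hl0)
  rw [abs_mul, abs_of_pos hm0] at h1
  have h2 : |F| * m0 ≤ (2 * (a + b) * l0 * sF) * m0 := by
    calc |F| * m0 ≤ a * l0 * m0 * sO + l0 * (b * m0 * sO) := h1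
      _ = (a + b) * l0 * m0 * sO := by ring
      _ ≤ (a + b) * l0 * m0 * (2 * sF) := mul_le_mul_of_nonneg_left hs (by positivity)
      _ = (2 * (a + b) * l0 * sF) * m0 := by ring
  exact le_of_mul_le_mul_right h2 hm0

/-- `√a√b ≤ 2√a'√b'` when `a ≤ 2a'`, `b ≤ 2b'` (all non-negative). [folklore] -/
theorem sqrt_mul_sqrt_le_two {a b a' b' : ℝ} (ha : a ≤ 2 * a') (hb : b ≤ 2 * b') :
    Real.sqrt a * Real.sqrt b ≤ 2 * (Real.sqrt a' * Real.sqrt b') := by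
  have h1 : Real.sqrt a ≤ Real.sqrt 2 * Real.sqrt a' := by
    rw [← Real.sqrt_mul (by norm_num : (0:ℝ) ≤ 2)]; exact Real.sqrt_le_sqrt ha
  have h2 : Real.sqrt b ≤ Real.sqrt 2 * Real.sqrt b' := by
    rw [← Real.sqrt_mul (by norm_num : (0:ℝ) ≤ 2)]; exact Real.sqrt_le_sqrt hb
  have h22 : Real.sqrt 2 * Real.sqrt 2 = 2 := Real.mul_self_sqrt (by norm_num)
  calc Real.sqrt a * Real.sqrt b ≤ (Real.sqrt 2 * Real.sqrt a') * (Real.sqrt 2 * Real.sqrt b') :=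
        mul_le_mul h1 h2 (Real.sqrt_nonneg _) (mul_nonneg (Real.sqrt_nonneg _) (Real.sqrt_nonneg _))
    _ = (Real.sqrt 2 * Real.sqrt 2) * (Real.sqrt a' * Real.sqrt b') := by ring
    _ = 2 * (Real.sqrt a' * Real.sqrt b') := by rw [h22]

/-! ## §4 ★ The composition: (A) ∧ (B) ⟹ the registered r3 text of S-POS -/

/-- ★★ **`UniversalityAt` (all levels) ∧ `PScalingDressedAt` (all levels) ⟹ `Stmt.stub_liftPosition` (r3 text)**: pick the PF vacua, any lift basis
(`exists_liftBasis`), relabel it by PScaling's `τ`, read Universality for the relabelled basis, and transfer (o5′)(o6′) to the fine dressed family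
(`o5_transfer`, `o6_transfer`; constant `4(C_A + C_B)`, level `min lam0_A lam0_B (1/(4(C_A+1)))`). [cite: Luscher1983, §3] -/
theorem liftPositionR3_of_universality_pscaling (hA : ∀ k, UniversalityAt k) (hB : ∀ k, PScalingDressedAt k) : LiftPositionR3 := by
  intro k
  obtain ⟨CA, lA, hCA, hlA, hAk⟩ := hA k
  obtain ⟨CB, lB, hCB, hlB, hBk⟩ := hB k
  refine ⟨4 * (CA + CB), min lA (min lB (1 / (4 * (CA + 1)))), by positivity, lt_min hlA (lt_min hlB (by positivity)),
    fun lam hlam hle => ?_⟩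
  obtain ⟨LA, hLA⟩ := hAk lam hlam (hle.trans (min_le_left _ _))
  obtain ⟨LB, hLB⟩ := hBk lam hlam (hle.trans ((min_le_right _ _).trans (min_le_left _ _)))
  have hlamC : lam ≤ 1 / (4 * (CA + 1)) := (hle.trans (min_le_right _ _)).trans (min_le_right _ _)
  refine ⟨max LA LB, fun L _ hL β hW φ hφ => ?_⟩
  have hleA : LA ≤ L := (le_max_left _ _).trans hL
  have hleB : LB ≤ L := (le_max_right _ _).trans hL
  have hβ0 : 0 ≤ β := zero_le_one.trans hW.1
  have hΛpos : 0 < luscherLambda β L := luscherLambda_pos_of_window hlam hW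
  have hLpos : (0 : ℝ) < L := Nat.cast_pos.mpr (NeZero.pos L)
  have hB1pos : 0 < liftCoupling β L := by unfold liftCoupling; exact div_pos two_pos (pow_pos hΛpos 3)
  have hBpos : 0 < oneSiteCoupling β L := by
    unfold oneSiteCoupling; exact div_pos (mul_pos two_pos (pow_pos hLpos 3)) (pow_pos hΛpos 3)
  -- the one-site Perron–Frobenius vacuum at `B`
  obtain ⟨e₀, θ, c, he₀, -, -, hn₀, heig₀, -, -, -⟩ := PhysL2.exists_groundState (L := 1) (oneSiteCoupling β L)
  have heig₀' : transferApply (oneSiteCoupling β L) e₀ = levelValue su2Rep 1 (oneSiteCoupling β L) 0 • e₀ := by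
    rw [levelValue_zero]; exact heig₀
  have hvac₀ : IsRawVacuum (L := 1) (oneSiteCoupling β L) e₀ := ⟨he₀, hn₀, heig₀'⟩
  -- some lift basis, relabelled by PScaling
  obtain ⟨ω, g, hbasis⟩ := exists_liftBasis hB1pos k
  obtain ⟨τ, hB0, hB5, hB6⟩ := hLB L hleB (luscherLambda β L) hW.2.1 hW.2.2 ω g hbasis e₀ hvac₀
  have hbasis' : LiftBasis (liftCoupling β L) k ω (fun i => g (τ i)) := liftBasis_reindex hbasis τ
  obtain ⟨hAn, hA5, hA6⟩ := hLA L hleA β hW φ hφ ω (fun i => g (τ i)) hbasis' e₀ hvac₀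
  -- abbreviations
  set u := dressedLiftFamily β φ (fun i => g (τ i)) with hu
  set w := shadowFamily (oneSiteCoupling β L) L e₀ (fun i => g (τ i)) with hw
  set l0 := levelValue su2Rep L β 0 with hl0
  set m0 := levelValue su2Rep 1 (oneSiteCoupling β L) 0 with hm0
  have hm0pos : 0 < m0 := levelValue_su2Rep_pos (L := 1) hBpos 0
  have hl0nn : 0 ≤ l0 := levelValue_su2Rep_nonneg L hβ0 0
  have huP : ∀ i, IsPhys (u i) := fun i => isPhys_dressedLiftVec β hφ.1 (hbasis'.2.2.2.2.1 i)
  have hEA : 0 < Real.exp (CA * luscherLambda β L ^ 2 / L) := Real.exp_pos _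
  have hEB : 0 < Real.exp (CB * luscherLambda β L ^ 2 / L) := Real.exp_pos _
  have hEE : Real.exp (CA * luscherLambda β L ^ 2 / L) * Real.exp (CB * luscherLambda β L ^ 2 / L) ≤
      Real.exp (4 * (CA + CB) * luscherLambda β L ^ 2 / L) := by
    rw [← Real.exp_add]
    apply Real.exp_le_exp.mpr
    have : 0 ≤ (CA + CB) * luscherLambda β L ^ 2 / L := div_nonneg (mul_nonneg (add_nonneg hCA hCB) (sq_nonneg _)) hLpos.le
    have e : CA * luscherLambda β L ^ 2 / ↑L + CB * luscherLambda β L ^ 2 / ↑L = (CA + CB) * luscherLambda β L ^ 2 / L := by ring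
    have e' : 4 * (CA + CB) * luscherLambda β L ^ 2 / ↑L = 4 * ((CA + CB) * luscherLambda β L ^ 2 / L) := by ring
    rw [e, e']; linarith
  -- `C_A λ ≤ 1/2`
  have hCAl : CA * luscherLambda β L ≤ 1 / 2 := by
    have h1 : luscherLambda β L ≤ 2 * lam := hW.2.2
    have h2 : CA * luscherLambda β L ≤ CA * (2 * (1 / (4 * (CA + 1)))) :=
      mul_le_mul_of_nonneg_left (h1.trans (by linarith)) hCA
    have h3 : CA * (2 * (1 / (4 * (CA + 1)))) = (CA / (CA + 1)) * (1 / 2) := by field_simp; ring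
    have h4 : CA / (CA + 1) ≤ 1 := by rw [div_le_one (by linarith)]; linarith
    calc CA * luscherLambda β L ≤ (CA / (CA + 1)) * (1 / 2) := h2.trans (le_of_eq h3)
      _ ≤ 1 * (1 / 2) := mul_le_mul_of_nonneg_right h4 (by norm_num)
      _ = 1 / 2 := one_mul _
  have hnw_le : ∀ i : Fin k, l2 (w i) (w i) ≤ 2 * l2 (u i) (u i) := fun i => by
    have h := (abs_le.mp (hAn i)).1
    have hnw : 0 ≤ l2 (w i) (w i) := l2_self_nonneg _
    nlinarith [mul_le_mul_of_nonneg_right hCAl hnw]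
  refine ⟨ω, fun i => g (τ i), hbasis', fun i => ?_, fun i l hil => ?_⟩
  · -- (o5)
    have hdf : 0 ≤ l2 (u i) (transferApply β (u i)) := by
      rw [← qform_eq_l2_transferApply]; exact qform_su2Rep_self_nonneg hβ0 (huP i)
    obtain ⟨h1, h2⟩ := o5_transfer (hB0 i) hm0pos (l2_self_nonneg (u i)) hl0nn hEA hEB (hA5 i).1 (hA5 i).2 (hB5 i).1 (hB5 i).2
    have hY1 : 0 ≤ levelValue su2Rep 1 (oneSiteCoupling β L) ((i : ℕ) + 1) * l0 * l2 (u i) (u i) :=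
      mul_nonneg (mul_nonneg (levelValue_su2Rep_nonneg 1 hBpos.le _) hl0nn) (l2_self_nonneg _)
    have hY2 : 0 ≤ l2 (u i) (transferApply β (u i)) * m0 := mul_nonneg hdf hm0pos.le
    constructor
    · calc l2 (u i) (transferApply β (u i)) * m0
          ≤ Real.exp (CA * luscherLambda β L ^ 2 / L) * Real.exp (CB * luscherLambda β L ^ 2 / L) *
              (levelValue su2Rep 1 (oneSiteCoupling β L) ((i : ℕ) + 1) * l0) * l2 (u i) (u i) := h1
        _ = Real.exp (CA * luscherLambda β L ^ 2 / L) * Real.exp (CB * luscherLambda β L ^ 2 / L) *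
              (levelValue su2Rep 1 (oneSiteCoupling β L) ((i : ℕ) + 1) * l0 * l2 (u i) (u i)) := by ring
        _ ≤ Real.exp (4 * (CA + CB) * luscherLambda β L ^ 2 / L) *
              (levelValue su2Rep 1 (oneSiteCoupling β L) ((i : ℕ) + 1) * l0 * l2 (u i) (u i)) := mul_le_mul_of_nonneg_right hEE hY1
        _ = Real.exp (4 * (CA + CB) * luscherLambda β L ^ 2 / L) *
              (levelValue su2Rep 1 (oneSiteCoupling β L) ((i : ℕ) + 1) * l0) * l2 (u i) (u i) := by ring
    · calc levelValue su2Rep 1 (oneSiteCoupling β L) ((i : ℕ) + 1) * l0 * l2 (u i) (u i)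
          ≤ Real.exp (CA * luscherLambda β L ^ 2 / L) * Real.exp (CB * luscherLambda β L ^ 2 / L) *
              (l2 (u i) (transferApply β (u i)) * m0) := h2
        _ ≤ Real.exp (4 * (CA + CB) * luscherLambda β L ^ 2 / L) * (l2 (u i) (transferApply β (u i)) * m0) :=
            mul_le_mul_of_nonneg_right hEE hY2
  · -- (o6)
    have hs : Real.sqrt (l2 (w i) (w i)) * Real.sqrt (l2 (w l) (w l)) ≤
        2 * (Real.sqrt (l2 (u i) (u i)) * Real.sqrt (l2 (u l) (u l))) :=
      sqrt_mul_sqrt_le_two (hnw_le i) (hnw_le l)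
    have ht2 : 0 ≤ luscherLambda β L ^ 2 / L := div_nonneg (sq_nonneg _) hLpos.le
    have h := o6_transfer hm0pos hl0nn (hA6 i l hil) (hB6 i l hil) hs (mul_nonneg hCA ht2) (mul_nonneg hCB ht2)
    calc _ ≤ 2 * (CA * (luscherLambda β L ^ 2 / L) + CB * (luscherLambda β L ^ 2 / L)) * l0 *
            (Real.sqrt (l2 (u i) (u i)) * Real.sqrt (l2 (u l) (u l))) := h
      _ ≤ 4 * (CA + CB) * (luscherLambda β L ^ 2 / L) * l0 * (Real.sqrt (l2 (u i) (u i)) * Real.sqrt (l2 (u l) (u l))) := by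
          have hx : 0 ≤ (CA + CB) * (luscherLambda β L ^ 2 / L) * l0 * (Real.sqrt (l2 (u i) (u i)) * Real.sqrt (l2 (u l) (u l))) :=
            mul_nonneg (mul_nonneg (mul_nonneg (add_nonneg hCA hCB) ht2) hl0nn) (mul_nonneg (Real.sqrt_nonneg _) (Real.sqrt_nonneg _))
          nlinarith

end Summit.QuantumFields.YangMills.Theorems.FemtoTransferGap.PolyakovLift

end
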